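import Literature.AlgebraicGeometry.Motives.HodgeThetaSubalgebraUnitaryFourTwoCore
import Literature.AlgebraicGeometry.Motives.HodgeThetaSubalgebraUnitaryRestrictEquiv
import Literature.AlgebraicGeometry.Motives.HodgeThetaSubalgebraRadicalKill
import Mathlib.Algebra.Lie.Killing
import HarnessLib

/-!
# A rational Lie subalgebra of `𝔲_K(V, ψ)` whose complexification contains `Θ` is all of `𝔲_K(V, ψ)` when `K` acts with multiplicities `(4, 2)` — THEOREM L⁗ (Moonen–Zarhin 1999 (2.3)–(2.5), Table 1 row IV`(4,2)`: simple abelian sixfolds with `End⁰ = k`; Ribet 1983 Thm. 3 beyond the coprime range)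

Family `hodge`, layer `Literature/AlgebraicGeometry/Motives` (abstract polarizable `ℚ`-Hodge structures; no geometry).
Written for the cell `pub-hodgeav-hg6` (req-37 (A) row 2 «base of HC ladder», TABLE X row 8-`(4,2)`, brick H1 of the
`(4,2)` unitary programme; HONEST FRAMING of that cell: HC / HC_AV / HC_CM / H2 are NOT proved — this file is
UNCONDITIONAL Hodge–Lie linear algebra; theorems only, no definition, no named fact (D-0026), no `sorry`).

This is the `(4,2)` companion of THEOREM L′ (`HodgeThetaSubalgebraUnitary`, multiplicities `(m,1)`), L″
(`…UnitaryTwoThree`, `(2,3)`) and L‴ (`…UnitaryTwoOdd`, `(2,b)`, `b` odd).  For `(4,2)` the complex core ALONE is false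
(Moonen–Zarhin (2.5): the irreducible skeleton `ℂ ⊕ 𝔰𝔩₂ ⊗ 1 ⊕ 1 ⊗ 𝔰𝔩₃` on `W = ℂ² ⊗ ℂ³` carries a `(2,4)` grading involution),
and the exclusion of the skeleton is ARITHMETIC.  Accordingly the proof is the ASSEMBLY of the cell's bricks, all in the tree:
the complex core V5 `UnitaryThetaCore.top_or_radical_two_four` («`End(W)`, or a non-zero `T`-commuting radical of
`tr_W − ¾κ` on the derived algebra»), the socket U1d `UnitaryTheta.exists_restrict_lieEquiv` (restriction to `W` is a Lie
isomorphism transporting `κ`), U1c `UnitaryTheta.trace_mul_eq_two_mul_trace_restrict` (`tr_V = 2·tr_W`) and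
`killingForm_spanC_baseChange_mem_range` (`κ` rational on rational pairs), U1b `UnitaryTheta.mul_theta_comm_of_forall_mem_eigenspace`
(commutation with `Θ` detected on `W`) and `trace_baseChange_mul_baseChange_mem_range`, and the radical kill U1
`ThetaSubalgebra.eq_zero_of_radical_of_forall_radical_commute_theta` (a rational invariant form on `𝔡(𝔤)` whose radical
commutes with `Θ` has zero radical).  Nothing of those files is restated.

SETTING (as in the `(m,1)` / `(2,3)` files). `H` an effective polarizable `ℚ`-Hodge structure of weight `1` on `V`, `ψ` a
polarization, `φ ∈ E = End_Hdg(V)` with `φ² = -d` (`d > 0`) and `E = ℚ + ℚφ` (`End⁰ = k` imaginary quadratic); `μ² = -d`,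
`W = ker(φ_ℂ − μ)`, and the MULTIPLICITY HYPOTHESIS `{dim W^{1,0}, dim W^{0,1}} = {2, 4}`.

PROVED HERE.
* §1 **`eq_top_of_sup_span_one_eq_top`** (linear algebra, any field): a bracket-closed `𝔊 ⊆ End(W)` with
  `𝔊 + K·1 = End(W)` containing an operator of non-zero trace is `End(W)` (elementary matrices: `𝔊` contains every
  commutator, hence every `E_ij`, `i ≠ j`, and every `E_ii − E_jj`; subtracting them from `T` leaves `tr(T)·E₀₀ ∈ 𝔊`).
  **`commutator_mem_spanC_derived`**: `[𝔤_ℂ, 𝔤_ℂ] ⊆ 𝔡(𝔤)_ℂ`.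
* §2 **`UnitaryThetaFourTwo.mem_spanC_of_commute_of_skew`** — for ANY bracket-closed `ℚ`-subspace `𝔤 ⊆ 𝔲_K(V,ψ)`
  (commuting with `E`, `ψ`-skew) whose complex span contains an operator `Θ` acting by `2p − 1` on `V^{p,1−p}`: every
  `Y ∈ End(V_ℂ)` commuting with `φ_ℂ` and `ψ_ℂ`-skew lies in `𝔤_ℂ` — **`𝔤_ℂ = 𝔲_K(V,ψ)_ℂ`**.  Proof: the restrictions
  of `𝔤_ℂ` to `W` form a bracket-closed irreducible `𝔊 ∋ Θ|_W` (`UnitaryTheta.eq_bot_or_eq_of_stable`); V5 applied to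
  `𝔊 + ℂ·1`: the branch `End(W)` gives `𝔊 = End(W)` by §1 (`tr Θ|_W = ∓2 ≠ 0`) and `Y ∈ 𝔤_ℂ` by determination on `W`; the
  radical branch gives, through U1d/U1c, a non-zero radical vector of the RATIONAL form `Ψ = ½·tr_V − ¾·κ` on `𝔡(𝔤)_ℂ` all of
  whose radical vectors commute with `Θ` (U1b) — impossible by the radical kill U1.
* §3 **`UnitaryThetaFourTwo.mem_hodgeLieC_of_commute_of_skew`** — the same for `𝔤 = Lie Hg(H)`: LITERALLY the hypothesis
  `hU` of the cell's slots / census modules (`UnitaryHodgeGroupSlotsHodgeClasses`, L13 `SixfoldTableXCensusUnitaryGeneralRow`),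
  i.e. Moonen–Zarhin (2.3) «`Hg = U_k(V,ψ)`» for Type IV(1,1) with multiplicities `(4,2)`, in Lie form.

## References
* [MoonenZarhin1999LowDim] B. Moonen, Yu. Zarhin, *Hodge classes on abelian varieties of low dimension*, Math. Ann. 315
  (1999), §2 (2.3)–(2.5) and Table 1 (row IV, `(n′,n″) = (4,2)`).
* [Ribet1983] K. A. Ribet, *Hodge classes on certain types of abelian varieties*, Amer. J. Math. 105 (1983), Thm. 3.
* [Deligne1982HodgeCycles] P. Deligne, *Hodge cycles on abelian varieties*, LNM 900 (1982), I §3 Prop. 3.4, Prop. 3.6.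
* [Humphreys1972] J. E. Humphreys, *Introduction to Lie Algebras and Representation Theory*, §5.1, §19.1.
-/

noncomputable section

open scoped TensorProduct

namespace Literature.AlgebraicGeometry.Motives

namespace HodgeStructure

/-! ## §1 Linear algebra: scalars from a non-zero trace; brackets of `𝔤_ℂ` lie in `𝔡(𝔤)_ℂ` -/

section LinearAlgebra

/-- **A bracket-closed `𝔊 ⊆ End(W)` with `𝔊 + K·1 = End(W)` and an element of non-zero trace is `End(W)`.**  Every
commutator `XY − YX` of `End(W)` is a commutator of elements of `𝔊`, hence in `𝔊`; along a basis, the elementary operators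
`E_ij` (`i ≠ j`) and `E_ii − E₀₀` are commutators, and `T − Σ_{i≠j} t_ij E_ij − Σ_i t_ii (E_ii − E₀₀) = tr(T)·E₀₀`, so
`E₀₀ ∈ 𝔊` and `1 = Σ_i (E_ii − E₀₀) + dim(W)·E₀₀ ∈ 𝔊` (`𝔤𝔩 = 𝔰𝔩 ⊕ K`, and `𝔰𝔩` is spanned by commutators).
[cite: Humphreys1972, §19.1] -/
theorem eq_top_of_sup_span_one_eq_top {K W : Type*} [Field K] [AddCommGroup W] [Module K W]
    [FiniteDimensional K W] {𝔊 : Submodule K (Module.End K W)} (hbr : ∀ F ∈ 𝔊, ∀ G ∈ 𝔊, F * G - G * F ∈ 𝔊)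
    (hsup : 𝔊 ⊔ (K ∙ (1 : Module.End K W)) = ⊤) {T : Module.End K W} (hT : T ∈ 𝔊)
    (htr : LinearMap.trace K W T ≠ 0) : 𝔊 = ⊤ := by
  classical
  -- every commutator of `End(W)` lies in `𝔊`
  have hdec : ∀ Y : Module.End K W, ∃ Y₁ ∈ 𝔊, ∃ a : K, Y = Y₁ + a • 1 := fun Y => by
    obtain ⟨Y₁, hY₁, Y₂, hY₂, rfl⟩ := Submodule.mem_sup.1 (hsup ▸ Submodule.mem_top (x := Y))
    obtain ⟨a, rfl⟩ := Submodule.mem_span_singleton.1 hY₂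
    exact ⟨Y₁, hY₁, a, rfl⟩
  have hcomm : ∀ X Y : Module.End K W, X * Y - Y * X ∈ 𝔊 := by
    intro X Y
    obtain ⟨X₁, hX₁, a, rfl⟩ := hdec X
    obtain ⟨Y₁, hY₁, c, rfl⟩ := hdec Y
    have h : (X₁ + a • (1 : Module.End K W)) * (Y₁ + c • 1) - (Y₁ + c • 1) * (X₁ + a • 1) = X₁ * Y₁ - Y₁ * X₁ := by
      refine LinearMap.ext fun w => ?_
      simp only [LinearMap.sub_apply, Module.End.mul_apply, LinearMap.add_apply, LinearMap.smul_apply,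
        Module.End.one_apply, map_add, map_smul]
      module
    rw [h]
    exact hbr X₁ hX₁ Y₁ hY₁
  -- `W ≠ 0`
  have hm : 0 < Module.finrank K W := by
    rcases Nat.eq_zero_or_pos (Module.finrank K W) with h | h
    · haveI : Subsingleton W := Module.finrank_zero_iff.1 h
      exact absurd (by rw [Subsingleton.elim T 0, map_zero]) htr
    · exact h
  -- elementary operators along a basis
  set b := Module.finBasis K W with hb
  set i₀ : Fin (Module.finrank K W) := ⟨0, hm⟩ with hi₀
  set E : Fin (Module.finrank K W) → Fin (Module.finrank K W) → Module.End K W :=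
    fun i j => (b.coord j).smulRight (b i) with hEdef
  have hEb : ∀ i j k, E i j (b k) = if j = k then b i else 0 := fun i j k => by
    simp only [hEdef, LinearMap.smulRight_apply, Module.Basis.coord_apply, Module.Basis.repr_self,
      Finsupp.single_apply]
    by_cases h : j = k
    · rw [if_pos h.symm, if_pos h, one_smul]
    · rw [if_neg (Ne.symm h), if_neg h, zero_smul]
  have hEE : ∀ i j k l, E i j * E k l = if j = k then E i l else 0 := fun i j k l => by
    refine b.ext fun r => ?_
    rw [Module.End.mul_apply, hEb]
    by_cases hlr : l = r
    · rw [if_pos hlr, hEb]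
      by_cases hjk : j = k
      · rw [if_pos hjk, if_pos hjk, hEb, if_pos hlr]
      · rw [if_neg hjk, if_neg hjk, LinearMap.zero_apply]
    · rw [if_neg hlr, map_zero]
      by_cases hjk : j = k
      · rw [if_pos hjk, hEb, if_neg hlr]
      · rw [if_neg hjk, LinearMap.zero_apply]
  have hdiag : ∀ i, E i i - E i₀ i₀ ∈ 𝔊 := fun i => by
    by_cases h : i = i₀
    · rw [h, sub_self]; exact 𝔊.zero_mem
    · have hc := hcomm (E i i₀) (E i₀ i)
      rwa [hEE, hEE, if_pos rfl, if_pos rfl] at hc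
  have hoff : ∀ i j, i ≠ j → E i j ∈ 𝔊 := fun i j hij => by
    have hc := hcomm (E i i) (E i j)
    rwa [hEE, hEE, if_pos rfl, if_neg (Ne.symm hij), sub_zero] at hc
  -- expansion of `T` and its trace
  set M := LinearMap.toMatrix b b T with hM
  have hTsum : T = ∑ i, ∑ j, M i j • E i j := by
    refine b.ext fun k => ?_
    simp only [LinearMap.coe_sum, Finset.sum_apply, LinearMap.smul_apply, hEb, smul_ite, smul_zero,
      Finset.sum_ite_eq', Finset.mem_univ, if_true, hM, LinearMap.toMatrix_apply]
    exact (b.sum_repr (T (b k))).symm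
  have htrace : LinearMap.trace K W T = ∑ i, M i i := by
    rw [LinearMap.trace_eq_matrix_trace K b T, hM]
    rfl
  -- `tr(T)·E₀₀ ∈ 𝔊`
  have hS : ∑ i, ∑ j, (M i j • E i j - if i = j then M i j • E i₀ i₀ else 0) ∈ 𝔊 := by
    refine Submodule.sum_mem _ fun i _ => Submodule.sum_mem _ fun j _ => ?_
    by_cases hij : i = j
    · subst hij
      rw [if_pos rfl, ← smul_sub]
      exact 𝔊.smul_mem _ (hdiag i)
    · rw [if_neg hij, sub_zero]
      exact 𝔊.smul_mem _ (hoff i j hij)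
  have hkey : T - ∑ i, ∑ j, (M i j • E i j - if i = j then M i j • E i₀ i₀ else 0) =
      (LinearMap.trace K W T) • E i₀ i₀ := by
    simp only [Finset.sum_sub_distrib, Finset.sum_ite_eq, Finset.mem_univ, if_true]
    rw [← hTsum, htrace, Finset.sum_smul, sub_sub_cancel]
  have hE₀ : E i₀ i₀ ∈ 𝔊 := by
    have h := 𝔊.sub_mem hT hS
    rw [hkey] at h
    exact (𝔊.smul_mem_iff htr).1 h
  -- `1 ∈ 𝔊`
  have hone : (1 : Module.End K W) = ∑ i, E i i := by
    refine b.ext fun k => ?_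
    simp only [Module.End.one_apply, LinearMap.coe_sum, Finset.sum_apply, hEb, Finset.sum_ite_eq',
      Finset.mem_univ, if_true]
  have h1 : (1 : Module.End K W) ∈ 𝔊 := by
    have h : ∑ i, E i i = ∑ i, (E i i - E i₀ i₀) + ∑ _i : Fin (Module.finrank K W), E i₀ i₀ := by
      rw [Finset.sum_sub_distrib, sub_add_cancel]
    rw [hone, h]
    exact 𝔊.add_mem (𝔊.sum_mem fun i _ => hdiag i) (𝔊.sum_mem fun _ _ => hE₀)
  rw [eq_top_iff, ← hsup]
  exact sup_le le_rfl ((Submodule.span_singleton_le_iff_mem _ _).2 h1)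

/-- **The trace of an involution is `dim P − dim Q`** (`P`, `Q` its `±1`-eigenspaces; `char K ≠ 2`): `T = π_P − π_Q` with
the complementary projections `π_P = ½(1 + T)`, `π_Q = ½(1 − T)` (`LinearMap.IsProj.trace`). [cite: Humphreys1972, §19.1] -/
theorem trace_eq_of_involution {K W : Type*} [Field K] [AddCommGroup W] [Module K W] [FiniteDimensional K W]
    (h2 : (2 : K) ≠ 0) {T : Module.End K W} (hTT : T * T = 1) {P Q : Submodule K W}
    (hP : ∀ x, x ∈ P ↔ T x = x) (hQ : ∀ x, x ∈ Q ↔ T x = -x) :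
    LinearMap.trace K W T = (Module.finrank K P : K) - (Module.finrank K Q : K) := by
  have hTT' : ∀ w, T (T w) = w := fun w => by rw [← Module.End.mul_apply, hTT, Module.End.one_apply]
  have hπP : LinearMap.IsProj P ((2 : K)⁻¹ • (1 + T)) := by
    constructor
    · intro x
      rw [hP, LinearMap.smul_apply, LinearMap.add_apply, Module.End.one_apply, LinearMap.map_smul, map_add,
        hTT', add_comm]
    · intro x hx
      rw [hP] at hx
      rw [LinearMap.smul_apply, LinearMap.add_apply, Module.End.one_apply, hx, ← two_smul K x, smul_smul,
        inv_mul_cancel₀ h2, one_smul]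
  have hπQ : LinearMap.IsProj Q ((2 : K)⁻¹ • (1 - T)) := by
    constructor
    · intro x
      rw [hQ, LinearMap.smul_apply, LinearMap.sub_apply, Module.End.one_apply, LinearMap.map_smul, map_sub,
        hTT', ← smul_neg, neg_sub]
    · intro x hx
      rw [hQ] at hx
      rw [LinearMap.smul_apply, LinearMap.sub_apply, Module.End.one_apply, hx, sub_neg_eq_add, ← two_smul K x,
        smul_smul, inv_mul_cancel₀ h2, one_smul]
  have hsplit : (2 : K)⁻¹ • (1 + T) - (2 : K)⁻¹ • (1 - T) = T := by
    rw [← smul_sub, add_sub_sub_cancel, ← two_smul K T, smul_smul, inv_mul_cancel₀ h2, one_smul]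
  rw [← hsplit, map_sub, hπP.trace, hπQ.trace]

universe u

variable {V : Type u} [AddCommGroup V] [Module ℚ V]

/-- **Brackets of elements of `𝔤_ℂ` lie in `𝔡(𝔤)_ℂ`**, the complex span of the rational derived algebra
`𝔡(𝔤) = span_ℚ {XY − YX : X, Y ∈ 𝔤}` (bilinearity of the commutator; extension of scalars is multiplicative).
[cite: Deligne1982HodgeCycles, I §3 (proof of Prop. 3.4)] -/
theorem commutator_mem_spanC_derived {𝔤 : Submodule ℚ (Module.End ℚ V)} {Y Z : Module.End ℂ (ℂ ⊗[ℚ] V)}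
    (hY : Y ∈ spanC 𝔤) (hZ : Z ∈ spanC 𝔤) :
    Y * Z - Z * Y ∈ spanC (Submodule.span ℚ {B | ∃ X ∈ 𝔤, ∃ X' ∈ 𝔤, X * X' - X' * X = B}) := by
  induction hY using Submodule.span_induction generalizing Z with
  | mem Y' hY' =>
    obtain ⟨X, hX, rfl⟩ := hY'
    induction hZ using Submodule.span_induction with
    | mem Z' hZ' =>
      obtain ⟨X', hX', rfl⟩ := hZ'
      rw [← LinearMap.baseChange_mul, ← LinearMap.baseChange_mul, ← LinearMap.baseChange_sub]
      exact baseChange_mem_spanC (Submodule.subset_span ⟨X, hX, X', hX', rfl⟩)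
    | zero => rw [mul_zero, zero_mul, sub_zero]; exact Submodule.zero_mem _
    | add Z₁ Z₂ _ _ h₁ h₂ =>
      have h : X.baseChange ℂ * (Z₁ + Z₂) - (Z₁ + Z₂) * X.baseChange ℂ =
          (X.baseChange ℂ * Z₁ - Z₁ * X.baseChange ℂ) + (X.baseChange ℂ * Z₂ - Z₂ * X.baseChange ℂ) := by
        rw [mul_add, add_mul]; abel
      rw [h]; exact Submodule.add_mem _ h₁ h₂
    | smul c Z₁ _ h₁ =>
      rw [mul_smul_comm, smul_mul_assoc, ← smul_sub]; exact Submodule.smul_mem _ c h₁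
  | zero => rw [zero_mul, mul_zero, sub_zero]; exact Submodule.zero_mem _
  | add Y₁ Y₂ _ _ h₁ h₂ =>
    have h : (Y₁ + Y₂) * Z - Z * (Y₁ + Y₂) = (Y₁ * Z - Z * Y₁) + (Y₂ * Z - Z * Y₂) := by
      rw [add_mul, mul_add]; abel
    rw [h]; exact Submodule.add_mem _ (h₁ hZ) (h₂ hZ)
  | smul c Y₁ _ h₁ =>
    rw [smul_mul_assoc, mul_smul_comm, ← smul_sub]; exact Submodule.smul_mem _ c (h₁ hZ)

end LinearAlgebra

/-! ## §2 The `(4,2)` theorem for an admissible `𝔤` -/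

section Main

universe u

variable {V : Type u} [AddCommGroup V] [Module ℚ V] {n : ℤ}

set_option maxHeartbeats 1600000 in
/-- **`𝔤_ℂ ⊇ 𝔲_K(V, ψ)_ℂ` for multiplicities `(2,4)` or `(4,2)` — the main theorem** (Moonen–Zarhin (2.3)–(2.5), Table 1,
row IV `(4,2)`: «`Hg = U_k`»; module docstring).  For `𝔤 ⊆ End_ℚ(V)` rational, bracket-closed, commuting with
`E = ℚ + ℚφ`, `ψ`-skew, with `Θ ∈ 𝔤_ℂ`, and `{dim W^{1,0}, dim W^{0,1}} = {2,4}` for `W = ker(φ_ℂ − μ)`: every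
`φ_ℂ`-commuting `ψ_ℂ`-skew operator lies in `𝔤_ℂ`.  PROOF = assembly of the tree's bricks: V5
`UnitaryThetaCore.top_or_radical_two_four` on the restriction algebra `𝔊 + ℂ·1 ⊆ End(W)`; branch `End(W)`: §1 and
determination on `W`; radical branch: U1d/U1c transport the radical of `tr_W − ¾κ` to a non-zero radical vector of the
rational form `½tr_V − ¾κ` on `𝔡(𝔤)_ℂ` whose radical commutes with `Θ` (U1b), contradicting the radical kill U1.
[cite: MoonenZarhin1999LowDim, §2 (2.3)–(2.5) and Table 1] [cite: Ribet1983, Thm. 3]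
[cite: Deligne1982HodgeCycles, I §3 Prop. 3.4 and Prop. 3.6] -/
theorem UnitaryThetaFourTwo.mem_spanC_of_commute_of_skew [Module.Finite ℚ V] (H : HodgeStructure V n)
    (hn : n = 1) (heff : H.IsEffective) (ψ : H.Polarization) {φ : Module.End ℚ V} (hφE : φ ∈ H.endAlg)
    {d : ℚ} (hd : 0 < d) (hφ2 : φ * φ = -(d • 1)) (hE : ∀ a ∈ H.endAlg, ∃ x y : ℚ, a = x • 1 + y • φ)
    {μ : ℂ} (hμ : μ ^ 2 = -(d : ℂ))
    (h24 : (Module.finrank ℂ ↥(Module.End.eigenspace (φ.baseChange ℂ) μ ⊓ H.piece 1 0) = 2 ∧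
        Module.finrank ℂ ↥(Module.End.eigenspace (φ.baseChange ℂ) μ ⊓ H.piece 0 1) = 4) ∨
      (Module.finrank ℂ ↥(Module.End.eigenspace (φ.baseChange ℂ) μ ⊓ H.piece 1 0) = 4 ∧
        Module.finrank ℂ ↥(Module.End.eigenspace (φ.baseChange ℂ) μ ⊓ H.piece 0 1) = 2))
    (𝔤 : Submodule ℚ (Module.End ℚ V)) (hbr : ∀ X ∈ 𝔤, ∀ X' ∈ 𝔤, X * X' - X' * X ∈ 𝔤)
    {Θ : Module.End ℂ (ℂ ⊗[ℚ] V)} (hΘ : ∀ p, ∀ x ∈ H.piece p (n - p), Θ x = ((2 * p - n : ℤ) : ℂ) • x)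
    (hΘ𝔤 : Θ ∈ spanC 𝔤)
    (hcomm : ∀ X ∈ 𝔤, ∀ a : H.endAlg, X * (a : Module.End ℚ V) = (a : Module.End ℚ V) * X)
    (hskew : ∀ X ∈ 𝔤, ∀ v w, ψ.form (X v) w + ψ.form v (X w) = 0)
    {Y : Module.End ℂ (ℂ ⊗[ℚ] V)} (hYφ : Y * φ.baseChange ℂ = φ.baseChange ℂ * Y)
    (hYskew : ∀ x y, ψ.form.baseChange ℂ (Y x) y + ψ.form.baseChange ℂ x (Y y) = 0) :
    Y ∈ spanC 𝔤 := by
  classical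
  letI iQ : LieRing (Module.End ℚ V) := LieRing.ofAssociativeRing
  letI iV : LieRing (Module.End ℂ (ℂ ⊗[ℚ] V)) := LieRing.ofAssociativeRing
  obtain ⟨hPhat, hQhat, hΘ10, hΘ01, hΘΘ⟩ := UnitaryTheta.theta_facts H hn heff hΘ
  set W := Module.End.eigenspace (φ.baseChange ℂ) μ with hWdef
  letI iW : LieRing (Module.End ℂ W) := LieRing.ofAssociativeRing
  have h𝔊W : ∀ Z ∈ spanC 𝔤, ∀ s ∈ W, Z s ∈ W := fun Z hZ s hs =>
    UnitaryTheta.apply_mem_eigenspace_of_commute (UnitaryTheta.commute_of_mem_spanC H hφE hcomm hZ) hs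
  have h𝔊br : ∀ Z ∈ spanC 𝔤, ∀ Z' ∈ spanC 𝔤, Z * Z' - Z' * Z ∈ spanC 𝔤 := fun Z hZ Z' hZ' =>
    commutator_mem_spanC hbr hZ hZ'
  -- a non-zero vector of `W`, hence `V` is nontrivial
  have hWpos : 0 < Module.finrank ℂ ↥(W ⊓ H.piece 1 0) := by rcases h24 with ⟨h, -⟩ | ⟨h, -⟩ <;> omega
  haveI : Nontrivial ↥(W ⊓ H.piece 1 0) := Module.nontrivial_of_finrank_pos (R := ℂ) hWpos
  obtain ⟨⟨x₀, hx₀⟩, hx₀0⟩ := exists_ne (0 : ↥(W ⊓ H.piece 1 0))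
  have hx₀0' : x₀ ≠ 0 := fun h => hx₀0 (Subtype.ext h)
  haveI : Nontrivial V := by
    by_contra hV
    have hsub : Subsingleton V := not_nontrivial_iff_subsingleton.1 hV
    have hzero : ∀ x : ℂ ⊗[ℚ] V, x = 0 := fun x => by
      induction x using TensorProduct.induction_on with
      | zero => rfl
      | tmul c v => rw [Subsingleton.elim v 0, TensorProduct.tmul_zero]
      | add x y hx hy => rw [hx, hy, add_zero]
    exact hx₀0' (hzero x₀)
  -- the restricted Lie algebra `𝔊 ⊆ End(W)`
  set 𝔊 : Submodule ℂ (Module.End ℂ W) :=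
    { carrier := {F | ∃ Z ∈ spanC 𝔤, ∀ w : W, (F w : ℂ ⊗[ℚ] V) = Z w}
      zero_mem' := ⟨0, Submodule.zero_mem _, fun w => by simp⟩
      add_mem' := by
        rintro F F' ⟨Z, hZ, hF⟩ ⟨Z', hZ', hF'⟩
        exact ⟨Z + Z', Submodule.add_mem _ hZ hZ', fun w => by
          rw [LinearMap.add_apply, Submodule.coe_add, hF, hF', LinearMap.add_apply]⟩
      smul_mem' := by
        rintro c F ⟨Z, hZ, hF⟩
        exact ⟨c • Z, Submodule.smul_mem _ c hZ, fun w => by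
          rw [LinearMap.smul_apply, Submodule.coe_smul, hF, LinearMap.smul_apply]⟩ } with h𝔊def
  have hmem𝔊 : ∀ F, F ∈ 𝔊 ↔ ∃ Z ∈ spanC 𝔤, ∀ w : W, (F w : ℂ ⊗[ℚ] V) = Z w := fun F => Iff.rfl
  have hres : ∀ Z ∈ spanC 𝔤, ∃ F ∈ 𝔊, ∀ w : W, (F w : ℂ ⊗[ℚ] V) = Z w := fun Z hZ =>
    ⟨Z.restrict fun s hs => h𝔊W Z hZ s hs, ⟨Z, hZ, fun w => rfl⟩, fun w => rfl⟩
  have hbr𝔊 : ∀ F ∈ 𝔊, ∀ F' ∈ 𝔊, F * F' - F' * F ∈ 𝔊 := by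
    intro F hF F' hF'
    obtain ⟨Z, hZ, hFZ⟩ := (hmem𝔊 F).1 hF
    obtain ⟨Z', hZ', hFZ'⟩ := (hmem𝔊 F').1 hF'
    refine (hmem𝔊 _).2 ⟨Z * Z' - Z' * Z, h𝔊br Z hZ Z' hZ', fun w => ?_⟩
    rw [LinearMap.sub_apply, Submodule.coe_sub, Module.End.mul_apply, Module.End.mul_apply, hFZ, hFZ', hFZ', hFZ,
      LinearMap.sub_apply, Module.End.mul_apply, Module.End.mul_apply]
  -- `Θ|_W`
  set ΘW : Module.End ℂ W := Θ.restrict fun s hs => h𝔊W Θ hΘ𝔤 s hs with hΘWdef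
  have hΘWapply : ∀ w : W, (ΘW w : ℂ ⊗[ℚ] V) = Θ w := fun w => rfl
  have hΘW𝔊 : ΘW ∈ 𝔊 := (hmem𝔊 _).2 ⟨Θ, hΘ𝔤, hΘWapply⟩
  have hΘWΘW : ΘW * ΘW = 1 := LinearMap.ext fun w => Subtype.ext (by
    rw [Module.End.mul_apply, hΘWapply, hΘWapply, hΘΘ, Module.End.one_apply])
  have hΘWΘW' : ∀ w, ΘW (ΘW w) = w := fun w => by
    rw [← Module.End.mul_apply, hΘWΘW, Module.End.one_apply]
  -- irreducibility of `W` under `𝔊`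
  have hirr𝔊 : ∀ U : Submodule ℂ W, (∀ F ∈ 𝔊, ∀ u ∈ U, F u ∈ U) → U = ⊥ ∨ U = ⊤ := by
    intro U hU
    have hU' : ∀ X ∈ 𝔤, ∀ u ∈ U.map W.subtype, X.baseChange ℂ u ∈ U.map W.subtype := by
      rintro X hX _ ⟨u, hu, rfl⟩
      obtain ⟨F, hF, hFZ⟩ := hres _ (baseChange_mem_spanC hX)
      exact ⟨F u, hU F hF u hu, hFZ u⟩
    rcases UnitaryTheta.eq_bot_or_eq_of_stable H hn heff ψ hφE hd hφ2 hE hμ 𝔤 hΘ hΘ𝔤 hcomm hskew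
        (U := U.map W.subtype) (Submodule.map_subtype_le W U) hU' with h | h
    · left
      rw [eq_bot_iff]
      intro u hu
      rw [Submodule.mem_bot]
      apply Subtype.ext
      have : (u : ℂ ⊗[ℚ] V) ∈ U.map W.subtype := ⟨u, hu, rfl⟩
      rw [h, Submodule.mem_bot] at this
      exact this
    · right
      rw [eq_top_iff]
      intro w _
      have hw : (w : ℂ ⊗[ℚ] V) ∈ U.map W.subtype := by rw [h]; exact w.2
      obtain ⟨u, hu, huw⟩ := hw
      have : u = w := Subtype.ext huw
      exact this ▸ hu
  -- the eigenspaces of `Θ|_W` and their dimensions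
  set PW : Submodule ℂ W := LinearMap.ker (ΘW - 1) with hPWdef
  set QW : Submodule ℂ W := LinearMap.ker (ΘW + 1) with hQWdef
  have hPW : ∀ x, x ∈ PW ↔ ΘW x = x := fun x => by
    rw [hPWdef, LinearMap.mem_ker, LinearMap.sub_apply, Module.End.one_apply, sub_eq_zero]
  have hQW : ∀ x, x ∈ QW ↔ ΘW x = -x := fun x => by
    rw [hQWdef, LinearMap.mem_ker, LinearMap.add_apply, Module.End.one_apply, add_eq_zero_iff_eq_neg]
  have hPWeq : PW = Submodule.comap W.subtype (W ⊓ H.piece 1 0) := by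
    ext x
    rw [hPW, Submodule.mem_comap, Submodule.subtype_apply, Submodule.mem_inf]
    constructor
    · intro h
      have hx : Θ x = x := by rw [← hΘWapply, h]
      refine ⟨x.2, ?_⟩
      have hx' : (x : ℂ ⊗[ℚ] V) = (2 : ℂ)⁻¹ • ((x : ℂ ⊗[ℚ] V) + Θ x) := by rw [hx]; module
      rw [hx']
      exact hPhat _
    · rintro ⟨-, hx10⟩
      apply Subtype.ext
      rw [hΘWapply]
      exact hΘ10 _ hx10
  have hQWeq : QW = Submodule.comap W.subtype (W ⊓ H.piece 0 1) := by
    ext x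
    rw [hQW, Submodule.mem_comap, Submodule.subtype_apply, Submodule.mem_inf]
    constructor
    · intro h
      have hx : Θ x = -x := by rw [← hΘWapply, h, Submodule.coe_neg]
      refine ⟨x.2, ?_⟩
      have hx' : (x : ℂ ⊗[ℚ] V) = (2 : ℂ)⁻¹ • ((x : ℂ ⊗[ℚ] V) - Θ x) := by rw [hx]; module
      rw [hx']
      exact hQhat _
    · rintro ⟨-, hx01⟩
      apply Subtype.ext
      rw [hΘWapply, Submodule.coe_neg]
      exact hΘ01 _ hx01
  have hfinP : Module.finrank ℂ PW = Module.finrank ℂ ↥(W ⊓ H.piece 1 0) := by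
    rw [hPWeq]; exact (Submodule.comapSubtypeEquivOfLe inf_le_left).finrank_eq
  have hfinQ : Module.finrank ℂ QW = Module.finrank ℂ ↥(W ⊓ H.piece 0 1) := by
    rw [hQWeq]; exact (Submodule.comapSubtypeEquivOfLe inf_le_left).finrank_eq
  -- `𝔊' = 𝔊 + ℂ·1`, to which the complex core V5 applies
  set 𝔊' : Submodule ℂ (Module.End ℂ W) := 𝔊 ⊔ (ℂ ∙ (1 : Module.End ℂ W)) with h𝔊'def
  have hbr_smul : ∀ (Y₁ Z₁ : Module.End ℂ W) (a c : ℂ),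
      (Y₁ + a • (1 : Module.End ℂ W)) * (Z₁ + c • 1) - (Z₁ + c • 1) * (Y₁ + a • 1) = Y₁ * Z₁ - Z₁ * Y₁ := by
    intro Y₁ Z₁ a c
    refine LinearMap.ext fun w => ?_
    simp only [LinearMap.sub_apply, Module.End.mul_apply, LinearMap.add_apply, LinearMap.smul_apply,
      Module.End.one_apply, map_add, map_smul]
    module
  have hdec : ∀ F ∈ 𝔊', ∃ F₁ ∈ 𝔊, ∃ a : ℂ, F = F₁ + a • 1 := fun F hF => by
    obtain ⟨F₁, hF₁, F₂, hF₂, rfl⟩ := Submodule.mem_sup.1 hF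
    obtain ⟨a, rfl⟩ := Submodule.mem_span_singleton.1 hF₂
    exact ⟨F₁, hF₁, a, rfl⟩
  have hbr' : ∀ F ∈ 𝔊', ∀ G ∈ 𝔊', F * G - G * F ∈ 𝔊' := by
    intro F hF G hG
    obtain ⟨F₁, hF₁, a, rfl⟩ := hdec F hF
    obtain ⟨G₁, hG₁, c, rfl⟩ := hdec G hG
    rw [hbr_smul]
    exact Submodule.mem_sup_left (hbr𝔊 F₁ hF₁ G₁ hG₁)
  have hirr' : ∀ U : Submodule ℂ W, (∀ F ∈ 𝔊', ∀ u ∈ U, F u ∈ U) → U = ⊥ ∨ U = ⊤ := fun U hU =>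
    hirr𝔊 U fun F hF u hu => hU F (Submodule.mem_sup_left hF) u hu
  have h1' : (1 : Module.End ℂ W) ∈ 𝔊' := Submodule.mem_sup_right (Submodule.mem_span_singleton_self _)
  have hC : Submodule.span ℂ {B | ∃ F ∈ 𝔊', ∃ G ∈ 𝔊', F * G - G * F = B} =
      Submodule.span ℂ {B | ∃ F ∈ 𝔊, ∃ G ∈ 𝔊, F * G - G * F = B} := by
    apply le_antisymm
    · rw [Submodule.span_le]
      rintro _ ⟨F, hF, G, hG, rfl⟩
      obtain ⟨F₁, hF₁, a, rfl⟩ := hdec F hF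
      obtain ⟨G₁, hG₁, c, rfl⟩ := hdec G hG
      rw [SetLike.mem_coe, hbr_smul]
      exact Submodule.subset_span ⟨F₁, hF₁, G₁, hG₁, rfl⟩
    · apply Submodule.span_mono
      rintro _ ⟨F, hF, G, hG, rfl⟩
      exact ⟨F, Submodule.mem_sup_left hF, G, Submodule.mem_sup_left hG, rfl⟩
  -- the complex core V5: `𝔊' = End(W)`, or the radical alternative (with `T = Θ|_W` in both orientations)
  have hcore : 𝔊' = ⊤ ∨ ∀ 𝔏 : LieSubalgebra ℂ (Module.End ℂ W),
      𝔏.toSubmodule = Submodule.span ℂ {B | ∃ F ∈ 𝔊', ∃ G ∈ 𝔊', F * G - G * F = B} →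
      ∃ Z : 𝔏, Z ≠ 0 ∧
        (∀ Y : 𝔏, LinearMap.trace ℂ W ((Z : Module.End ℂ W) * (Y : Module.End ℂ W)) =
          (3 / 4 : ℂ) * killingForm ℂ 𝔏 Z Y) ∧
        ∀ R : 𝔏, (∀ Y : 𝔏, LinearMap.trace ℂ W ((R : Module.End ℂ W) * (Y : Module.End ℂ W)) =
            (3 / 4 : ℂ) * killingForm ℂ 𝔏 R Y) →
          (R : Module.End ℂ W) * ΘW = ΘW * (R : Module.End ℂ W) := by
    rcases h24 with ⟨h2, h4⟩ | ⟨h4, h2⟩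
    · exact UnitaryThetaCore.top_or_radical_two_four hbr' h1' hirr' (Submodule.mem_sup_left hΘW𝔊) hΘWΘW hPW hQW
        (by rw [hfinP, h2]) (by rw [hfinQ, h4])
    · have hnΘ : -ΘW ∈ 𝔊' := Submodule.mem_sup_left (𝔊.neg_mem hΘW𝔊)
      have hnΘΘ : (-ΘW) * (-ΘW) = 1 := LinearMap.ext fun w => by
        rw [Module.End.mul_apply, LinearMap.neg_apply, LinearMap.neg_apply, map_neg, neg_neg, hΘWΘW',
          Module.End.one_apply]
      rcases UnitaryThetaCore.top_or_radical_two_four hbr' h1' hirr' hnΘ hnΘΘ (P := QW) (Q := PW)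
          (fun x => by rw [hQW, LinearMap.neg_apply, neg_eq_iff_eq_neg])
          (fun x => by rw [hPW, LinearMap.neg_apply, neg_inj]) (by rw [hfinQ, h2]) (by rw [hfinP, h4]) with h | h
      · exact Or.inl h
      · refine Or.inr fun 𝔏 h𝔏 => ?_
        obtain ⟨Z, hZ0, hZrad, hrad⟩ := h 𝔏 h𝔏
        refine ⟨Z, hZ0, hZrad, fun R hR => ?_⟩
        have hc := hrad R hR
        refine LinearMap.ext fun w => ?_
        have hcw := LinearMap.congr_fun hc w
        rw [Module.End.mul_apply, Module.End.mul_apply, LinearMap.neg_apply, LinearMap.neg_apply, map_neg,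
          neg_inj] at hcw
        rw [Module.End.mul_apply, Module.End.mul_apply]
        exact hcw
  rcases hcore with htop' | hradical
  · /- BRANCH 1: `𝔊 + ℂ·1 = End(W)`, hence `𝔊 = End(W)` since `tr(Θ|_W) = ±2 ≠ 0` (§1) -/
    have htrΘ : LinearMap.trace ℂ W ΘW ≠ 0 := by
      rw [trace_eq_of_involution two_ne_zero hΘWΘW hPW hQW, hfinP, hfinQ]
      rcases h24 with ⟨h2, h4⟩ | ⟨h4, h2⟩
      · rw [h2, h4]; norm_num
      · rw [h4, h2]; norm_num
    have htop : 𝔊 = ⊤ := eq_top_of_sup_span_one_eq_top hbr𝔊 htop' hΘW𝔊 htrΘ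
    -- `Y|_W` is induced by some `Z ∈ 𝔤_ℂ`, and `Y = Z` by determination on `W`
    have hYW : ∀ w ∈ W, Y w ∈ W := fun w hw => UnitaryTheta.apply_mem_eigenspace_of_commute hYφ hw
    obtain ⟨Z, hZ, hZY⟩ := (hmem𝔊 (Y.restrict hYW)).1 (htop ▸ Submodule.mem_top)
    have hD := UnitaryTheta.eq_zero_of_forall_mem_eigenspace H ψ hφE hd hφ2 hE hμ (D := Z - Y)
      (by rw [sub_mul, mul_sub, UnitaryTheta.commute_of_mem_spanC H hφE hcomm hZ, hYφ])
      (fun x y => by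
        have h3 := ThetaSubalgebra.formBaseChange_add_eq_zero_of_mem_spanC ψ hskew hZ x y
        have h4 := hYskew x y
        rw [LinearMap.sub_apply, LinearMap.sub_apply, map_sub, LinearMap.sub_apply, map_sub]
        linear_combination h3 - h4)
      (fun w hw => by
        rw [LinearMap.sub_apply, sub_eq_zero, ← hZY ⟨w, hw⟩]
        rfl)
    rw [sub_eq_zero] at hD
    exact hD ▸ hZ
  · /- BRANCH 2: the radical alternative contradicts the radical kill -/
    exfalso
    -- the rational derived algebra `𝔡 = 𝔡(𝔤)` and the Lie subalgebras `𝔡`, `𝔡_ℂ`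
    set 𝔡 : Submodule ℚ (Module.End ℚ V) := Submodule.span ℚ {B | ∃ X ∈ 𝔤, ∃ X' ∈ 𝔤, X * X' - X' * X = B}
      with h𝔡def
    have h𝔡𝔤 : 𝔡 ≤ 𝔤 := Literature.Algebra.Lie.TraceSeparating.derived_le 𝔤 hbr
    have hbr𝔡 : ∀ X ∈ 𝔡, ∀ X' ∈ 𝔡, X * X' - X' * X ∈ 𝔡 := fun X hX X' hX' =>
      Submodule.subset_span ⟨X, h𝔡𝔤 hX, X', h𝔡𝔤 hX', rfl⟩
    have h𝔡C𝔤 : spanC 𝔡 ≤ spanC 𝔤 := spanC_mono h𝔡𝔤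
    let 𝔏Q : LieSubalgebra ℚ (Module.End ℚ V) :=
      { 𝔡 with
        lie_mem' := fun {X X'} hX hX' => by
          rw [LieRing.of_associative_ring_bracket]
          exact hbr𝔡 X hX X' hX' }
    let 𝔏V : LieSubalgebra ℂ (Module.End ℂ (ℂ ⊗[ℚ] V)) :=
      { spanC 𝔡 with
        lie_mem' := fun {X X'} hX hX' => by
          rw [LieRing.of_associative_ring_bracket]
          exact commutator_mem_spanC hbr𝔡 hX hX' }
    have hmem𝔏V : ∀ X, X ∈ 𝔏V ↔ X ∈ spanC 𝔡 := fun X => Iff.rfl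
    have h𝔏V𝔏Q : 𝔏V.toSubmodule = spanC 𝔏Q.toSubmodule := rfl
    have h𝔏Vφ : ∀ X ∈ 𝔏V, X * φ.baseChange ℂ = φ.baseChange ℂ * X := fun X hX =>
      UnitaryTheta.commute_of_mem_spanC H hφE hcomm (h𝔡C𝔤 hX)
    have h𝔏Vskew : ∀ X ∈ 𝔏V, ∀ x y, ψ.form.baseChange ℂ (X x) y + ψ.form.baseChange ℂ x (X y) = 0 :=
      fun X hX x y => ThetaSubalgebra.formBaseChange_add_eq_zero_of_mem_spanC ψ hskew (h𝔡C𝔤 hX) x y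
    -- U1d: restriction to `W` is a Lie isomorphism `e : 𝔡_ℂ ≃ 𝔏W` transporting `κ`
    obtain ⟨𝔏W, e, he, hmem𝔏W, hκ⟩ :=
      UnitaryTheta.exists_restrict_lieEquiv H ψ hφE hd hφ2 hE hμ 𝔏V h𝔏Vφ h𝔏Vskew
    -- `𝔏W` is the span of the commutators of `𝔊` (= of `𝔊'`)
    set C𝔊 : Submodule ℂ (Module.End ℂ W) := Submodule.span ℂ {B | ∃ F ∈ 𝔊, ∃ G ∈ 𝔊, F * G - G * F = B}
      with hC𝔊def
    have hDres : ∀ D ∈ 𝔡, ∃ F ∈ C𝔊, ∀ w : W, (F w : ℂ ⊗[ℚ] V) = D.baseChange ℂ w := by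
      intro D hD
      induction hD using Submodule.span_induction with
      | mem D' hD' =>
        obtain ⟨X, hX, X', hX', rfl⟩ := hD'
        obtain ⟨F, hF, hFX⟩ := hres _ (baseChange_mem_spanC hX)
        obtain ⟨F', hF', hFX'⟩ := hres _ (baseChange_mem_spanC hX')
        refine ⟨F * F' - F' * F, Submodule.subset_span ⟨F, hF, F', hF', rfl⟩, fun w => ?_⟩
        rw [LinearMap.sub_apply, Submodule.coe_sub, Module.End.mul_apply, Module.End.mul_apply, hFX, hFX', hFX',
          hFX, LinearMap.baseChange_sub, LinearMap.baseChange_mul, LinearMap.baseChange_mul, LinearMap.sub_apply,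
          Module.End.mul_apply, Module.End.mul_apply]
      | zero =>
        exact ⟨0, C𝔊.zero_mem, fun w => by
          rw [LinearMap.zero_apply, Submodule.coe_zero, LinearMap.baseChange_zero, LinearMap.zero_apply]⟩
      | add D₁ D₂ _ _ h₁ h₂ =>
        obtain ⟨F₁, hF₁, hF₁D⟩ := h₁
        obtain ⟨F₂, hF₂, hF₂D⟩ := h₂
        exact ⟨F₁ + F₂, C𝔊.add_mem hF₁ hF₂, fun w => by
          rw [LinearMap.add_apply, Submodule.coe_add, hF₁D, hF₂D, LinearMap.baseChange_add, LinearMap.add_apply]⟩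
      | smul q D₁ _ h₁ =>
        obtain ⟨F₁, hF₁, hF₁D⟩ := h₁
        exact ⟨q • F₁, C𝔊.smul_of_tower_mem q hF₁, fun w => by
          rw [LinearMap.smul_apply, Submodule.coe_smul_of_tower, hF₁D, LinearMap.baseChange_smul,
            LinearMap.smul_apply]⟩
    have hXres : ∀ X ∈ spanC 𝔡, ∃ F ∈ C𝔊, ∀ w : W, (F w : ℂ ⊗[ℚ] V) = X w := by
      intro X hX
      induction hX using Submodule.span_induction with
      | mem X' hX' =>
        obtain ⟨D, hD, rfl⟩ := hX'
        exact hDres D hD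
      | zero => exact ⟨0, C𝔊.zero_mem, fun w => by rw [LinearMap.zero_apply, Submodule.coe_zero, LinearMap.zero_apply]⟩
      | add X₁ X₂ _ _ h₁ h₂ =>
        obtain ⟨F₁, hF₁, hF₁X⟩ := h₁
        obtain ⟨F₂, hF₂, hF₂X⟩ := h₂
        exact ⟨F₁ + F₂, C𝔊.add_mem hF₁ hF₂, fun w => by
          rw [LinearMap.add_apply, Submodule.coe_add, hF₁X, hF₂X, LinearMap.add_apply]⟩
      | smul c X₁ _ h₁ =>
        obtain ⟨F₁, hF₁, hF₁X⟩ := h₁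
        exact ⟨c • F₁, C𝔊.smul_mem c hF₁, fun w => by
          rw [LinearMap.smul_apply, Submodule.coe_smul, hF₁X, LinearMap.smul_apply]⟩
    have h𝔏WC : 𝔏W.toSubmodule = Submodule.span ℂ {B | ∃ F ∈ 𝔊', ∃ G ∈ 𝔊', F * G - G * F = B} := by
      rw [hC]
      apply le_antisymm
      · intro F hF
        rw [LieSubalgebra.mem_toSubmodule, hmem𝔏W] at hF
        obtain ⟨X, hX, hFX⟩ := hF
        obtain ⟨F', hF', hF'X⟩ := hXres X ((hmem𝔏V X).1 hX)
        have hFF' : F = F' := LinearMap.ext fun w => Subtype.ext ((hFX w).trans (hF'X w).symm)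
        rw [hFF']
        exact hF'
      · rw [Submodule.span_le]
        rintro _ ⟨F, hF, G, hG, rfl⟩
        rw [SetLike.mem_coe, LieSubalgebra.mem_toSubmodule, hmem𝔏W]
        obtain ⟨Z, hZ, hFZ⟩ := (hmem𝔊 F).1 hF
        obtain ⟨Z', hZ', hGZ⟩ := (hmem𝔊 G).1 hG
        refine ⟨Z * Z' - Z' * Z, (hmem𝔏V _).2 (commutator_mem_spanC_derived hZ hZ'), fun w => ?_⟩
        rw [LinearMap.sub_apply, Submodule.coe_sub, Module.End.mul_apply, Module.End.mul_apply, hFZ, hGZ, hGZ, hFZ,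
          LinearMap.sub_apply, Module.End.mul_apply, Module.End.mul_apply]
    -- U1c: `tr_V = 2·tr_W` along `e`
    have hWst : ∀ X Y : 𝔏V, ∀ w ∈ W,
        ((X : Module.End ℂ (ℂ ⊗[ℚ] V)) * (Y : Module.End ℂ (ℂ ⊗[ℚ] V))) w ∈ W :=
      fun X Y w hw => h𝔊W _ (h𝔡C𝔤 X.2) _ (h𝔊W _ (h𝔡C𝔤 Y.2) w hw)
    have htrW : ∀ X Y : 𝔏V,
        LinearMap.trace ℂ (ℂ ⊗[ℚ] V) ((X : Module.End ℂ (ℂ ⊗[ℚ] V)) * (Y : Module.End ℂ (ℂ ⊗[ℚ] V))) =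
          2 * LinearMap.trace ℂ W (((e X : 𝔏W) : Module.End ℂ W) * ((e Y : 𝔏W) : Module.End ℂ W)) := by
      intro X Y
      rw [UnitaryTheta.trace_mul_eq_two_mul_trace_restrict H hn ψ hφE hd hφ2 hE hμ (h𝔏Vφ _ X.2) (h𝔏Vφ _ Y.2)
        (h𝔏Vskew _ X.2) (h𝔏Vskew _ Y.2) (hWst X Y)]
      congr 2
      refine LinearMap.ext fun w => Subtype.ext ?_
      rw [LinearMap.coe_restrict_apply, Module.End.mul_apply, Module.End.mul_apply, he, he]
    -- the rational invariant form `Ψ = ½·tr_V − ¾·κ` on `𝔡_ℂ`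
    let Ψ : 𝔏V →ₗ[ℂ] 𝔏V →ₗ[ℂ] ℂ :=
      (2 : ℂ)⁻¹ • ((LinearMap.mul ℂ (Module.End ℂ (ℂ ⊗[ℚ] V))).compr₂
        (LinearMap.trace ℂ (ℂ ⊗[ℚ] V))).compl₁₂ (𝔏V.incl : 𝔏V →ₗ[ℂ] Module.End ℂ (ℂ ⊗[ℚ] V))
          (𝔏V.incl : 𝔏V →ₗ[ℂ] Module.End ℂ (ℂ ⊗[ℚ] V)) -
        (3 / 4 : ℂ) • killingForm ℂ 𝔏V
    have hΨ : ∀ X Y : 𝔏V, Ψ X Y = (2 : ℂ)⁻¹ * LinearMap.trace ℂ (ℂ ⊗[ℚ] V)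
        ((X : Module.End ℂ (ℂ ⊗[ℚ] V)) * (Y : Module.End ℂ (ℂ ⊗[ℚ] V))) - (3 / 4 : ℂ) * killingForm ℂ 𝔏V X Y :=
      fun X Y => rfl
    have hΨW : ∀ X Y : 𝔏V, Ψ X Y =
        LinearMap.trace ℂ W (((e X : 𝔏W) : Module.End ℂ W) * ((e Y : 𝔏W) : Module.End ℂ W)) -
          (3 / 4 : ℂ) * killingForm ℂ 𝔏W (e X) (e Y) := fun X Y => by
      rw [hΨ, htrW, hκ, ← mul_assoc, inv_mul_cancel₀ two_ne_zero, one_mul]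
    -- `Ψ` is rational on rational pairs (U1b, U1c)
    have hrat : ∀ (X : Module.End ℚ V) (hX : X ∈ 𝔡) (X' : Module.End ℚ V) (hX' : X' ∈ 𝔡), ∃ q : ℚ,
        Ψ ⟨X.baseChange ℂ, baseChange_mem_spanC hX⟩ ⟨X'.baseChange ℂ, baseChange_mem_spanC hX'⟩ = (q : ℂ) := by
      intro X hX X' hX'
      obtain ⟨q₁, hq₁⟩ := trace_baseChange_mul_baseChange_mem_range (V := V) X X'
      obtain ⟨q₂, hq₂⟩ := killingForm_spanC_baseChange_mem_range 𝔏Q 𝔏V h𝔏V𝔏Q ⟨X, hX⟩ ⟨X', hX'⟩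
        (baseChange_mem_spanC hX) (baseChange_mem_spanC hX')
      refine ⟨2⁻¹ * q₁ - 3 / 4 * q₂, ?_⟩
      rw [hΨ]
      push_cast
      rw [← hq₁, ← hq₂]
    -- a `Ψ`-radical vector restricts to a radical vector of `tr_W − ¾κ` on `𝔏W`
    have hrad_of : ∀ Z : 𝔏V,
        (∀ (X : Module.End ℚ V) (hX : X ∈ 𝔡), Ψ Z ⟨X.baseChange ℂ, baseChange_mem_spanC hX⟩ = 0) →
        ∀ Y' : 𝔏W, LinearMap.trace ℂ W (((e Z : 𝔏W) : Module.End ℂ W) * (Y' : Module.End ℂ W)) =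
          (3 / 4 : ℂ) * killingForm ℂ 𝔏W (e Z) Y' := by
      intro Z hZ Y'
      have hZ' : ∀ X : 𝔏V, Ψ Z X = 0 := by
        rintro ⟨X, hX⟩
        induction hX using Submodule.span_induction with
        | mem X' hX' =>
          obtain ⟨D, hD, rfl⟩ := hX'
          exact hZ D hD
        | zero => exact (Ψ Z).map_zero
        | add X₁ X₂ hX₁ hX₂ h₁ h₂ =>
          have h := (Ψ Z).map_add ⟨X₁, hX₁⟩ ⟨X₂, hX₂⟩
          rw [h₁, h₂, add_zero] at h
          exact h
        | smul c X₁ hX₁ h₁ =>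
          have h := (Ψ Z).map_smul c ⟨X₁, hX₁⟩
          rw [h₁, smul_zero] at h
          exact h
      have h := hZ' (e.symm Y')
      rw [hΨW, LieEquiv.apply_symm_apply, sub_eq_zero] at h
      exact h
    obtain ⟨Z₀, hZ₀0, hZ₀rad, hcommT⟩ := hradical 𝔏W h𝔏WC
    -- every `Ψ`-radical vector commutes with `Θ` (V5's radical clause + U1b)
    have hradΘ : ∀ Z : 𝔏V,
        (∀ (X : Module.End ℚ V) (hX : X ∈ 𝔡), Ψ Z ⟨X.baseChange ℂ, baseChange_mem_spanC hX⟩ = 0) →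
        (Z : Module.End ℂ (ℂ ⊗[ℚ] V)) * Θ = Θ * (Z : Module.End ℂ (ℂ ⊗[ℚ] V)) := by
      intro Z hZ
      have hc := hcommT (e Z) (hrad_of Z hZ)
      refine UnitaryTheta.mul_theta_comm_of_forall_mem_eigenspace H ψ hφE hd hφ2 hE hμ 𝔤 hbr hΘ𝔤 hcomm hskew
        (h𝔡C𝔤 Z.2) fun w hw => ?_
      have h := congrArg (fun F : Module.End ℂ W => ((F ⟨w, hw⟩ : W) : ℂ ⊗[ℚ] V)) hc
      simp only [Module.End.mul_apply, he, hΘWapply] at h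
      exact h
    -- the non-zero radical vector `Z₀` of V5 pulls back to a non-zero `Ψ`-radical vector: contradiction with U1
    set Z : 𝔏V := e.symm Z₀ with hZdef
    have heZ : e Z = Z₀ := LieEquiv.apply_symm_apply e Z₀
    have hZrad : ∀ (X : Module.End ℚ V) (hX : X ∈ 𝔡), Ψ Z ⟨X.baseChange ℂ, baseChange_mem_spanC hX⟩ = 0 := by
      intro X hX
      rw [hΨW, heZ, sub_eq_zero]
      exact hZ₀rad _
    have hZ0 : Z = 0 :=
      ThetaSubalgebra.eq_zero_of_radical_of_forall_radical_commute_theta H ψ 𝔤 hbr hΘ hΘ𝔤 hcomm hskew Ψ hrat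
        hradΘ hZrad
    apply hZ₀0
    rw [← heZ, hZ0]
    simp

/-! ## §3 The hypothesis `hU` of the slots / census modules, for `𝔤 = Lie Hg(H)` -/

/-- **Multiplicities `(4,2)` (or `(2,4)`): every `φ_ℂ`-commuting `ψ_ℂ`-skew operator lies in `Lie Hg(H) ⊗ ℂ`**
(Moonen–Zarhin (2.3) «`Hg(X) = U_k(V, ψ)`» for Type IV(1,1), `(n′, n″) = (4,2)`) — §2 for the admissible algebra
`𝔤 = Lie Hg(H)` (`commutator_mem_hodgeLie`, `mem_hodgeLieC_of_forall_piece`, `commute_of_mem_hodgeLie`,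
`form_apply_add_eq_zero_of_mem_hodgeLie`), read through `hodgeLieC_eq_spanC`: LITERALLY the hypothesis `hU` of
`UnitaryHodgeGroupSlotsHodgeClasses` / `…PowersHodgeClasses` / the census row 8-`(4,2)`.
[cite: MoonenZarhin1999LowDim, §2 (2.3) and Table 1] [cite: Ribet1983, Thm. 3] [cite: Deligne1982HodgeCycles, I §3 Prop. 3.4] -/
theorem UnitaryThetaFourTwo.mem_hodgeLieC_of_commute_of_skew [Module.Finite ℚ V] [HodgeTensorFacts.{u, u}]
    (H : HodgeStructure V n) (hn : n = 1) (heff : H.IsEffective) (ψ : H.Polarization) {φ : Module.End ℚ V}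
    (hφE : φ ∈ H.endAlg) {d : ℚ} (hd : 0 < d) (hφ2 : φ * φ = -(d • 1))
    (hE : ∀ a ∈ H.endAlg, ∃ x y : ℚ, a = x • 1 + y • φ) {μ : ℂ} (hμ : μ ^ 2 = -(d : ℂ))
    (h24 : (Module.finrank ℂ ↥(Module.End.eigenspace (φ.baseChange ℂ) μ ⊓ H.piece 1 0) = 2 ∧
        Module.finrank ℂ ↥(Module.End.eigenspace (φ.baseChange ℂ) μ ⊓ H.piece 0 1) = 4) ∨
      (Module.finrank ℂ ↥(Module.End.eigenspace (φ.baseChange ℂ) μ ⊓ H.piece 1 0) = 4 ∧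
        Module.finrank ℂ ↥(Module.End.eigenspace (φ.baseChange ℂ) μ ⊓ H.piece 0 1) = 2)) :
    ∀ Y : Module.End ℂ (ℂ ⊗[ℚ] V), Y * φ.baseChange ℂ = φ.baseChange ℂ * Y →
      (∀ x y, ψ.form.baseChange ℂ (Y x) y + ψ.form.baseChange ℂ x (Y y) = 0) → Y ∈ H.hodgeLieC :=
  fun Y hYφ hYskew => by
  obtain ⟨Θ, hΘ⟩ := exists_hodgeTheta H
  have hΘ𝔤 : Θ ∈ spanC H.hodgeLie := (hodgeLieC_eq_spanC H) ▸ H.mem_hodgeLieC_of_forall_piece hΘ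
  rw [hodgeLieC_eq_spanC]
  exact UnitaryThetaFourTwo.mem_spanC_of_commute_of_skew H hn heff ψ hφE hd hφ2 hE hμ h24 H.hodgeLie
    (fun X hX X' hX' => H.commutator_mem_hodgeLie hX hX') hΘ hΘ𝔤 (fun X hX a => H.commute_of_mem_hodgeLie hX a)
    (fun X hX => form_apply_add_eq_zero_of_mem_hodgeLie ψ hX) hYφ hYskew

end Main

end HodgeStructure

end Literature.AlgebraicGeometry.Motives

end
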